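import Mathlib.LinearAlgebra.Semisimple
import Mathlib.LinearAlgebra.Matrix.ToLin
import Mathlib.LinearAlgebra.Matrix.Charpoly.Minpoly
import Mathlib.RingTheory.SimpleModule.Basic
import HarnessLib

/-!
# K2 ∕ E3 «EllipticInputs», unit U12 — helper file for socket #10 `sig_K2E3OrbitClosureContainsSemisimple`:
# transport of `Module.End.IsSemisimple` (semilinear bijections, invariant decompositions, product rings, conjugation,
# inverse, transpose)

Cell `hodgecm-mathlib` (Track B «K2-LIT»), item h413 = `stmt-HodgeConjecture-24833`; author K2E3-p10 (g0).  PROOF lane, pure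
linear algebra over Mathlib (`Module.End.IsSemisimple`, `Module.End.invtSubmodule`, `Module.AEval'`), no definitions, no `sorry`.
These lemmas carry the semisimplicity of the limit point produced over the local FIELD `L_w` back to the socket's currency
`Module.End.IsSemisimple (Matrix.toLin' s)` over the PRODUCT ring `L ⊗ L⁺_v = Π_{w ∣ v} L_w`, and through the split-place frame
`g ↦ (g_w, c_* ((J g J⁻¹)⁻¹)ᵀ)`.

* `isSemisimple_iff_of_semilinear` — `f.IsSemisimple ↔ g.IsSemisimple` along a BIJECTIVE `σ`-semilinear map intertwining `f` and `g`
  (`σ` surjective), via `Module.End.isSemisimple_iff` and `Submodule.orderIsoMapComapOfBijective`;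
* `isSemisimple_of_iSup_eq_top` — an endomorphism that is semisimple on each member of an invariant family of submodules with
  `⨆ = ⊤` is semisimple (Mathlib `isSemisimpleModule_of_isSemisimpleModule_submodule'` on `AEval'`);
* `isSemisimple_toLin'_pi` — over `Π i, K i` a matrix is semisimple as soon as all its components are;
* `isSemisimple_toLin'_conj_iff`, `isSemisimple_toLin'_inv_iff`, `isSemisimple_toLin'_transpose_iff`,
  `isSemisimple_toLin'_map_iff` — invariance under `P M P⁻¹`, `M⁻¹`, `Mᵀ` (field, via the square-free minimal polynomial) and
  entrywise ring isomorphisms.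

References: N. Bourbaki, *Algèbre* VIII §9 (semisimple endomorphisms) — folklore.
-/

set_option autoImplicit false
set_option linter.dupNamespace false

namespace Summit.HodgeConjecture.HodgeConjecture.Cruxes.H413.K2E3OrbitClosureSemisimpleTransport

open Module Module.End Polynomial
open scoped Matrix

/-! ## §1 Semilinear transport -/

section Semilinear

variable {R S M N : Type*} [CommRing R] [CommRing S] [AddCommGroup M] [Module R M] [AddCommGroup N] [Module S N]
  {σ : R →+* S} [RingHomSurjective σ]

/-- Invariant submodules correspond under a bijective semilinear intertwiner: `p` is `f`-invariant iff `l(p)` is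
`g`-invariant. [folklore] -/
theorem map_mem_invtSubmodule_iff (l : M →ₛₗ[σ] N) (hl : Function.Bijective l) {f : End R M} {g : End S N}
    (h : ∀ x, l (f x) = g (l x)) (p : Submodule R M) :
    p.map l ∈ g.invtSubmodule ↔ p ∈ f.invtSubmodule := by
  simp only [mem_invtSubmodule_iff_forall_mem_of_mem]
  constructor
  · intro hp x hx
    have hx' : g (l x) ∈ p.map l := hp (l x) (Submodule.mem_map_of_mem hx)
    rw [← h] at hx'
    obtain ⟨y, hy, hyx⟩ := Submodule.mem_map.1 hx'
    rwa [← hl.1 hyx]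
  · rintro hp _ ⟨x, hx, rfl⟩
    rw [← h]
    exact Submodule.mem_map_of_mem (hp x hx)

/-- **Semisimplicity is invariant under bijective semilinear intertwiners** (`σ` surjective): if `l ∘ f = g ∘ l` then
`f` is semisimple iff `g` is.  (Mathlib's `LinearEquiv.isSemisimple_iff` is the `σ = id` case.) [folklore] -/
theorem isSemisimple_iff_of_semilinear (l : M →ₛₗ[σ] N) (hl : Function.Bijective l) {f : End R M} {g : End S N}
    (h : ∀ x, l (f x) = g (l x)) : f.IsSemisimple ↔ g.IsSemisimple := by
  let e := Submodule.orderIsoMapComapOfBijective l hl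
  have hcomap : ∀ q : Submodule S N, (q.comap l).map l = q := fun q =>
    Submodule.map_comap_eq_of_surjective hl.2 q
  rw [isSemisimple_iff, isSemisimple_iff]
  constructor
  · intro hf q hq
    have hq' : q.comap l ∈ f.invtSubmodule := by
      rw [← map_mem_invtSubmodule_iff l hl h, hcomap]; exact hq
    obtain ⟨r, hr, hqr⟩ := hf _ hq'
    refine ⟨r.map l, (map_mem_invtSubmodule_iff l hl h r).2 hr, ?_⟩
    have := (e.isCompl_iff).1 hqr
    simpa [e, hcomap] using this
  · intro hg p hp
    obtain ⟨r, hr, hpr⟩ := hg _ ((map_mem_invtSubmodule_iff l hl h p).2 hp)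
    refine ⟨r.comap l, ?_, ?_⟩
    · rw [← map_mem_invtSubmodule_iff l hl h, hcomap]; exact hr
    · rw [e.isCompl_iff]
      simpa [e, hcomap] using hpr

end Semilinear

/-! ## §2 Invariant decompositions -/

section ISup

variable {R M : Type*} [CommRing R] [AddCommGroup M] [Module R M]

/-- **Semisimple on the members of an invariant family with `⨆ = ⊤` ⇒ semisimple.**  If `N i` are `f`-invariant submodules
with `⨆ i, N i = ⊤` and each restriction `f|_{N i}` is semisimple, then `f` is semisimple (the `R[X]`-module `M_f` is generated
by the semisimple submodules `N i`). [folklore] -/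
theorem isSemisimple_of_iSup_eq_top {ι : Type*} (f : End R M) (N : ι → Submodule R M)
    (hN : ∀ i, N i ∈ f.invtSubmodule) (htop : ⨆ i, N i = ⊤)
    (hss : ∀ i, Module.End.IsSemisimple (f.restrict (hN i))) : f.IsSemisimple := by
  let P : ι → Submodule R[X] (AEval' f) := fun i => AEval.mapSubmodule R M f ⟨N i, hN i⟩
  have hP : ∀ i, IsSemisimpleModule R[X] (P i) := fun i =>
    (AEval.restrict_equiv_mapSubmodule f (N i) (hN i)).isSemisimpleModule_iff.1 (hss i)
  have hPtop : ⨆ i, P i = ⊤ := by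
    rw [eq_top_iff]
    intro m _
    have hx : (AEval'.of f).symm m ∈ ⨆ i, N i := by rw [htop]; exact Submodule.mem_top
    have key : ∀ x : M, x ∈ ⨆ i, N i → AEval'.of f x ∈ ⨆ i, P i := by
      intro x hx
      refine Submodule.iSup_induction N (motive := fun x => AEval'.of f x ∈ ⨆ i, P i) hx ?_ ?_ ?_
      · intro i x hxi
        refine Submodule.mem_iSup_of_mem i ?_
        change AEval'.of f x ∈ AEval.mapSubmodule R M f ⟨N i, hN i⟩
        rw [AEval.mem_mapSubmodule_apply]
        simpa using hxi
      · simp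
      · intro x y hx hy
        rw [map_add]
        exact Submodule.add_mem _ hx hy
    simpa using key _ hx
  exact isSemisimpleModule_of_isSemisimpleModule_submodule' hP hPtop

end ISup

/-! ## §3 Matrices over a product of rings -/

section PiRing

variable {ι : Type*} [Fintype ι] [DecidableEq ι] {K : ι → Type*} [∀ i, CommRing (K i)]
  {n : Type*} [Fintype n] [DecidableEq n]

/-- **Semisimplicity over `Π i, K i` is checked componentwise**: if every component `M_i ∈ M_n(K_i)` of a matrix `M` over the
product ring `Π i, K i` is semisimple (`Module.End.IsSemisimple (toLin' M_i)` over `K_i`), then `toLin' M` is semisimple over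
`Π i, K i` — the coordinate module `(Π K)^n` is the direct sum of the invariant pieces `e_i • (Π K)^n ≃ K_i^n` on which `Π K`
acts through `K_i`. [folklore] -/
theorem isSemisimple_toLin'_pi (M : Matrix n n (Π i, K i))
    (h : ∀ i, Module.End.IsSemisimple (Matrix.toLin' (M.map (Pi.evalRingHom K i)))) :
    Module.End.IsSemisimple (Matrix.toLin' M) := by
  set f : Module.End (Π i, K i) (n → Π i, K i) := Matrix.toLin' M with hf
  let e : ι → (Π i, K i) := fun i => Pi.single i 1
  let N : ι → Submodule (Π i, K i) (n → Π i, K i) := fun i =>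
    LinearMap.range (e i • (LinearMap.id : (n → Π i, K i) →ₗ[Π i, K i] (n → Π i, K i)))
  have hmemN : ∀ i (x : n → Π i, K i), x ∈ N i ↔ ∀ a j, j ≠ i → x a j = 0 := by
    intro i x
    constructor
    · rintro ⟨y, rfl⟩ a j hj
      simp [e, hj]
    · intro hx
      refine ⟨x, ?_⟩
      ext a j
      by_cases hj : j = i
      · subst hj; simp [e]
      · simp [e, hj, hx a j hj]
  have hN : ∀ i, N i ∈ f.invtSubmodule := by
    intro i
    rw [mem_invtSubmodule_iff_forall_mem_of_mem]
    rintro _ ⟨x, rfl⟩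
    exact ⟨f x, by simp⟩
  have htop : ⨆ i, N i = ⊤ := by
    rw [eq_top_iff]
    intro x _
    have hx : x = ∑ i, e i • x := by
      ext a j
      simp only [e, Finset.sum_apply, Pi.smul_apply, smul_eq_mul, Pi.mul_apply]
      rw [Finset.sum_eq_single j (fun b _ hb => by rw [Pi.single_eq_of_ne hb.symm, zero_mul])
        (fun hj => absurd (Finset.mem_univ j) hj), Pi.single_eq_same, one_mul]
    rw [hx]
    exact Submodule.sum_mem _ fun i _ => Submodule.mem_iSup_of_mem i ⟨x, rfl⟩
  refine isSemisimple_of_iSup_eq_top f N hN htop fun i => ?_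
  haveI : RingHomSurjective (Pi.evalRingHom K i) := ⟨fun y => ⟨Pi.single i y, by simp⟩⟩
  let l : N i →ₛₗ[Pi.evalRingHom K i] (n → K i) :=
    { toFun := fun x a => (x : n → Π i, K i) a i
      map_add' := fun _ _ => rfl
      map_smul' := fun _ _ => rfl }
  have hl : Function.Bijective l := by
    constructor
    · intro x y hxy
      apply Subtype.ext
      ext a j
      by_cases hj : j = i
      · subst hj; exact congrFun hxy a
      · rw [(hmemN _ _).1 x.2 a j hj, (hmemN _ _).1 y.2 a j hj]
    · intro z
      refine ⟨⟨fun a => Pi.single i (z a), (hmemN i _).2 fun a j hj => by simp [hj]⟩, ?_⟩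
      ext a
      simp [l]
  refine (isSemisimple_iff_of_semilinear l hl (f := f.restrict (hN i))
    (g := Matrix.toLin' (M.map (Pi.evalRingHom K i))) fun x => ?_).2 (h i)
  ext a
  simp only [l, LinearMap.coe_mk, AddHom.coe_mk, LinearMap.coe_restrict_apply, hf, Matrix.toLin'_apply,
    Matrix.mulVec, dotProduct, Finset.sum_apply, Pi.mul_apply, Matrix.map_apply, Pi.evalRingHom_apply]

end PiRing

/-! ## §4 Conjugation, inverse, transpose, entrywise ring isomorphisms -/

section Field

variable {R : Type*} [CommRing R] {n : Type*} [Fintype n] [DecidableEq n]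

/-- Semisimplicity of `toLin'` is invariant under conjugation `M ↦ P M Q` with `Q P = 1`. [folklore] -/
theorem isSemisimple_toLin'_conj_iff (P Q M : Matrix n n R) (hQP : Q * P = 1) :
    Module.End.IsSemisimple (Matrix.toLin' (P * M * Q)) ↔ Module.End.IsSemisimple (Matrix.toLin' M) := by
  have hPQ : P * Q = 1 := mul_eq_one_comm.1 hQP
  let e : (n → R) ≃ₗ[R] (n → R) :=
    LinearEquiv.ofLinear (Matrix.toLin' P) (Matrix.toLin' Q)
      (by rw [← Matrix.toLin'_mul, hPQ, Matrix.toLin'_one])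
      (by rw [← Matrix.toLin'_mul, hQP, Matrix.toLin'_one])
  refine (LinearEquiv.isSemisimple_iff (Matrix.toLin' M) (Matrix.toLin' (P * M * Q)) e ?_).symm
  change Matrix.toLin' P ∘ₗ Matrix.toLin' M = Matrix.toLin' (P * M * Q) ∘ₗ Matrix.toLin' P
  rw [← Matrix.toLin'_mul, ← Matrix.toLin'_mul, Matrix.mul_assoc, Matrix.mul_assoc, hQP, Matrix.mul_one]

/-- Entrywise transport along a bijective ring homomorphism preserves semisimplicity of `toLin'`. [folklore] -/
theorem isSemisimple_toLin'_map_iff {S : Type*} [CommRing S] (φ : R →+* S) (hφ : Function.Bijective φ)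
    (M : Matrix n n R) :
    Module.End.IsSemisimple (Matrix.toLin' (M.map φ)) ↔ Module.End.IsSemisimple (Matrix.toLin' M) := by
  haveI : RingHomSurjective φ := ⟨hφ.2⟩
  let l : (n → R) →ₛₗ[φ] (n → S) :=
    { toFun := fun x => φ ∘ x
      map_add' := fun x y => funext fun a => by simp
      map_smul' := fun r x => funext fun a => by simp }
  have hl : Function.Bijective l :=
    ⟨fun x y hxy => funext fun a => hφ.1 (congrFun hxy a),
     fun z => ⟨fun a => Function.surjInv hφ.2 (z a), funext fun a => Function.surjInv_eq hφ.2 (z a)⟩⟩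
  refine (isSemisimple_iff_of_semilinear l hl (f := Matrix.toLin' M) (g := Matrix.toLin' (M.map φ)) fun x => ?_).symm
  ext a
  simp only [l, LinearMap.coe_mk, AddHom.coe_mk, Function.comp_apply, Matrix.toLin'_apply]
  exact RingHom.map_mulVec φ M x a

variable {K : Type*} [Field K]

/-- For an invertible matrix over a field, `toLin' M⁻¹` and `toLin' M` have the same invariant subspaces. [folklore] -/
theorem mem_invtSubmodule_toLin'_inv {M : Matrix n n K} (hM : IsUnit M.det) {p : Submodule K (n → K)}
    (hp : p ∈ Module.End.invtSubmodule (Matrix.toLin' M)) : p ∈ Module.End.invtSubmodule (Matrix.toLin' M⁻¹) := by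
  have hinj : Function.Injective (Matrix.toLin' M) := by
    intro x y hxy
    have := congrArg (Matrix.toLin' M⁻¹) hxy
    rwa [← Matrix.toLin'_mul_apply, ← Matrix.toLin'_mul_apply, Matrix.nonsing_inv_mul _ hM, Matrix.toLin'_one,
      LinearMap.id_apply, LinearMap.id_apply] at this
  have hmap : p.map (Matrix.toLin' M) = p := by
    refine Submodule.eq_of_le_of_finrank_eq ((Module.End.mem_invtSubmodule_iff_map_le _).1 hp) ?_
    exact (LinearEquiv.finrank_eq (Submodule.equivMapOfInjective _ hinj p)).symm
  rw [Module.End.mem_invtSubmodule_iff_forall_mem_of_mem]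
  intro x hx
  rw [← hmap] at hx
  obtain ⟨y, hy, rfl⟩ := Submodule.mem_map.1 hx
  rwa [← Matrix.toLin'_mul_apply, Matrix.nonsing_inv_mul _ hM, Matrix.toLin'_one, LinearMap.id_apply]

/-- **`M⁻¹` is semisimple iff `M` is** (invertible matrices over a field). [folklore] -/
theorem isSemisimple_toLin'_inv_iff {M : Matrix n n K} (hM : IsUnit M.det) :
    Module.End.IsSemisimple (Matrix.toLin' M⁻¹) ↔ Module.End.IsSemisimple (Matrix.toLin' M) := by
  have hM' : IsUnit M⁻¹.det := Matrix.isUnit_nonsing_inv_det_iff.2 hM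
  have hiff : ∀ p : Submodule K (n → K),
      p ∈ Module.End.invtSubmodule (Matrix.toLin' M⁻¹) ↔ p ∈ Module.End.invtSubmodule (Matrix.toLin' M) :=
    fun p => ⟨fun hp => by simpa only [Matrix.nonsing_inv_nonsing_inv _ hM] using mem_invtSubmodule_toLin'_inv hM' hp,
      mem_invtSubmodule_toLin'_inv hM⟩
  simp only [Module.End.isSemisimple_iff, hiff]

/-- `(p(M))ᵀ = p(Mᵀ)` for a polynomial `p`. [folklore] -/
theorem transpose_aeval (M : Matrix n n R) (p : R[X]) : (aeval M p)ᵀ = aeval Mᵀ p := by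
  refine p.induction_on' (fun p q hp hq => by rw [map_add, Matrix.transpose_add, hp, hq, map_add]) fun k a => ?_
  simp only [aeval_monomial, Matrix.transpose_pow, Algebra.algebraMap_eq_smul_one, Matrix.transpose_smul,
    smul_mul_assoc, one_mul]

/-- The transpose of a semisimple matrix over a field is semisimple (same square-free minimal polynomial). [folklore] -/
theorem isSemisimple_toLin'_transpose {M : Matrix n n K} (h : Module.End.IsSemisimple (Matrix.toLin' M)) :
    Module.End.IsSemisimple (Matrix.toLin' Mᵀ) := by
  have hsq : Squarefree (minpoly K M) := by
    rw [← Matrix.minpoly_toLin']; exact h.minpoly_squarefree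
  refine Module.End.isSemisimple_of_squarefree_aeval_eq_zero hsq ?_
  have h1 : aeval Mᵀ (minpoly K M) = 0 := by
    rw [← transpose_aeval, minpoly.aeval, Matrix.transpose_zero]
  have h2 : aeval (Matrix.toLin' Mᵀ) (minpoly K M) = Matrix.toLinAlgEquiv' (aeval Mᵀ (minpoly K M)) := by
    change aeval (Matrix.toLinAlgEquiv' Mᵀ) (minpoly K M) = _
    rw [aeval_algEquiv]
    rfl
  rw [h2, h1, map_zero]

/-- **`Mᵀ` is semisimple iff `M` is** (matrices over a field). [folklore] -/
theorem isSemisimple_toLin'_transpose_iff (M : Matrix n n K) :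
    Module.End.IsSemisimple (Matrix.toLin' Mᵀ) ↔ Module.End.IsSemisimple (Matrix.toLin' M) :=
  ⟨fun h => by simpa only [Matrix.transpose_transpose] using isSemisimple_toLin'_transpose h,
    isSemisimple_toLin'_transpose⟩

end Field

end Summit.HodgeConjecture.HodgeConjecture.Cruxes.H413.K2E3OrbitClosureSemisimpleTransport
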